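import Summits.QuantumFields.BalabanUV.Beta.FP.StepDefectInherit

/-!
# `BalabanUV.Beta.FP.UltralocalDefect` — road «FP» for binder row D1, ROUTE T, the (STEP) door's `hSDF`: **AN ULTRALOCAL STEP DEFECT IS INVISIBLE TO THE
# SECOND MOMENT** — `B12Beta.secondMoment P μ ν = Σ_x P μ ν x · x_μ · x_ν` vanishes for every kernel supported at `x = 0`, is unchanged by adding such a
# kernel, ultralocality passes to entrywise limits, and hence the N2-inherit socket's finite-level row `hSDFj` (`StepDefectInherit.stepDefect_inherit`)
# holds for ANY ultralocal finite-level defect family; §4: ANY kernel even under the reflection `z_μ ↦ −z_μ` has zero `(μ, ν)` second moment for `μ ≠ ν` (odd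
# weight; unconditional `tsum` symmetry) — Bałaban's channels ((1.22) p. 264: «μ ≠ ν») — and the step law modulo such a term gives `hSDF` there.

WHY ∕ STATUS (owner's located question Q-FP-17-2′ «dead-bond insertions and the Haar Jacobian», journal [D1P3-G17-Q172P], and the row-D1 owner's answer
R-D1-g36-1 [AN2-G36-WORD-1]): in the literal AS TYPED the comb slice and the `U = 1` generators are STATIC (the rooted comb projector is background-independent,
nowhere differentiated), so the frame of record is `NestedStepLawOneShotLetters.secondVar_oneShot_nestedStepLaw_of_letters_static` (p311088 §2) and NO
Faddeev–Popov ∕ Haar term is a typed object; the second-order composite Ward rows are (T-ID) table identities still to be checked, and IF one fails the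
displayed-defect form `…_of_letters_haar` (p311351 §5) is the receptacle.  THIS FILE is the generic [folklore] bookkeeping deciding the FATE of such a residual
term in the (STEP) door's binder `hSDF : secondMoment (defect TP RP m) μ ν = 0` (`μ ≠ ν` in the END p307920): a kernel that vanishes off the origin (§1–§3), or ANY
kernel EVEN under the reflection `z_μ ↦ −z_μ` (§4, the natural route for a bubble-type residual — a per-bond scalar contracted through two
`ℋ`-columns is NOT ultralocal in the external separation, R-D1-g36-1 (D)), has zero `(μ, ν)` second moment, and the law «modulo such a kernel» gives `hSDF`.
It proves nothing about the literal's tables, discharges 0∕4 row-D1 binders, and is NOT (T-ID), NOT SDF, NOT D1, NOT BetaPertH, NOT continuum, NOT Clay.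

HONEST DEPENDENCY (page 1, mandatory): continuum YM on T⁴ ⇐ BetaPertH ∧ nine spine estimates (0/9 proved); BetaPertH ⇐ (D1) ∧ (D4) ∧ CAP+tail;
G-an2-4 gates asym, D1 and NE2/3/4.  HONEST FRAMING (cell contract, verbatim): «discharging `BetaPertH` makes Bałaban's UV stability UNCONDITIONAL —
a real constructive-QFT result; it is NOT the continuum limit and NOT the Clay problem.»  ABSOLUTE RULE (cell charter, verbatim): «No internally-minted
statement may enter as a cited fact. Every hypothesis is either kernel-proved in this package or a verbatim quotation of a PUBLISHED theorem with page
reference. The manuscript(s) under audit are NOT citable for their own disputed steps — they are the thing under adjudication; programme-internal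
(2001/route/tribunal) claims are never citable.»  No `def`, no `def … : Prop` (ultralocality is spelled out as the hypothesis `∀ μ ν x, x ≠ 0 → P μ ν x = 0`),
nothing cited, 0 sorry.  «not in print; our bookkeeping».
Provenance: road «FP» OWNER, unit b2b-balaban-beta-d1-p3 gen 17, 2026-08-22.  No existing file touched.
-/

noncomputable section

open Filter Topology
open scoped BigOperators

namespace Summit.QuantumFields.BalabanUV.Beta.FP.UltralocalDefect

open Literature.MathematicalPhysics.QuantumFieldTheory.Balaban1983to89
open Summit.QuantumFields.BalabanUV.Beta.FP.StepDefectInherit (defect)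

variable {d : ℕ}

/-! ## §1 Ultralocal kernels have zero second moment -/

/-- [folklore] the second-moment summand of an ultralocal kernel vanishes termwise: at `x = 0` the weight `x_μ x_ν` is zero, elsewhere the kernel is. -/
theorem summand_eq_zero_of_ultralocal (P : B12Beta.Kernel d) (h : ∀ μ ν x, x ≠ 0 → P μ ν x = 0) (μ ν : Fin d) (x : Fin d → ℤ) :
    P μ ν x * (x μ : ℝ) * (x ν : ℝ) = 0 := by
  by_cases hx : x = 0
  · subst hx; simp
  · rw [h μ ν x hx, zero_mul, zero_mul]

/-- [folklore] **AN ULTRALOCAL KERNEL HAS ZERO SECOND MOMENT** in every channel `(μ, ν)`. -/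
theorem secondMoment_eq_zero_of_ultralocal (P : B12Beta.Kernel d) (h : ∀ μ ν x, x ≠ 0 → P μ ν x = 0) (μ ν : Fin d) :
    B12Beta.secondMoment P μ ν = 0 := by
  unfold B12Beta.secondMoment
  simp only [summand_eq_zero_of_ultralocal P h μ ν, tsum_zero]

/-- [folklore] **TWO KERNELS THAT AGREE OFF THE ORIGIN HAVE THE SAME SECOND MOMENTS** (no summability needed: the summands are literally equal). -/
theorem secondMoment_congr_off_zero (P P' : B12Beta.Kernel d) (h : ∀ μ ν x, x ≠ 0 → P μ ν x = P' μ ν x) (μ ν : Fin d) :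
    B12Beta.secondMoment P μ ν = B12Beta.secondMoment P' μ ν := by
  unfold B12Beta.secondMoment
  refine tsum_congr fun x => ?_
  by_cases hx : x = 0
  · subst hx; simp
  · rw [h μ ν x hx]

/-- [folklore] **ADDING AN ULTRALOCAL KERNEL DOES NOT CHANGE THE SECOND MOMENT.** -/
theorem secondMoment_add_ultralocal (P D : B12Beta.Kernel d) (hD : ∀ μ ν x, x ≠ 0 → D μ ν x = 0) (μ ν : Fin d) :
    B12Beta.secondMoment (P + D) μ ν = B12Beta.secondMoment P μ ν :=
  secondMoment_congr_off_zero (P + D) P (fun μ' ν' x hx => by simp only [Pi.add_apply, hD μ' ν' x hx, add_zero]) μ ν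

/-- [folklore] **(SDF) MODULO AN ULTRALOCAL TERM**: if `P = Z + D` off the origin with `secondMoment Z μ ν = 0` and `D` ultralocal then `secondMoment P μ ν = 0`. -/
theorem secondMoment_eq_zero_of_eq_add_ultralocal (P Z D : B12Beta.Kernel d) (hP : ∀ μ ν x, x ≠ 0 → P μ ν x = Z μ ν x + D μ ν x)
    (hD : ∀ μ ν x, x ≠ 0 → D μ ν x = 0) (μ ν : Fin d) (hZ : B12Beta.secondMoment Z μ ν = 0) : B12Beta.secondMoment P μ ν = 0 := by
  rw [secondMoment_congr_off_zero P Z (fun μ' ν' x hx => by rw [hP μ' ν' x hx, hD μ' ν' x hx, add_zero]) μ ν, hZ]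

/-! ## §2 Ultralocality passes to entrywise limits -/

/-- [folklore] **AN ENTRYWISE LIMIT OF ULTRALOCAL KERNELS IS ULTRALOCAL** (the `M → ∞` ∕ `j → ∞` steps of route T keep the remark). -/
theorem ultralocal_of_tendsto {P : ℕ → B12Beta.Kernel d} {Pinf : B12Beta.Kernel d}
    (hlim : ∀ μ ν x, Tendsto (fun j => P j μ ν x) atTop (𝓝 (Pinf μ ν x))) (h : ∀ j μ ν x, x ≠ 0 → P j μ ν x = 0) :
    ∀ μ ν x, x ≠ 0 → Pinf μ ν x = 0 := by
  intro μ ν x hx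
  have hc : Tendsto (fun j => P j μ ν x) atTop (𝓝 0) := by
    simp only [h _ μ ν x hx]; exact tendsto_const_nhds
  exact tendsto_nhds_unique (hlim μ ν x) hc

/-! ## §3 The N2-inherit socket's finite-level row `hSDFj` from ultralocality -/

/-- [folklore] **`hSDFj` FOR AN ULTRALOCAL FINITE-LEVEL DEFECT FAMILY**: the row `∀ j m, 1 ≤ m → secondMoment (Dj j m) μ ν = 0` consumed by
`StepDefectInherit.stepDefect_inherit` holds as soon as every `Dj j m` (`m ≥ 1`) is supported at the origin. -/
theorem hSDFj_of_ultralocal {Dj : ℕ → ℕ → B12Beta.Kernel d} (h : ∀ j m, 1 ≤ m → ∀ μ ν x, x ≠ 0 → Dj j m μ ν x = 0) (μ ν : Fin d) :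
    ∀ j m, 1 ≤ m → B12Beta.secondMoment (Dj j m) μ ν = 0 := fun j m hm =>
  secondMoment_eq_zero_of_ultralocal (Dj j m) (h j m hm) μ ν

/-- [folklore] **`hSDF` AT THE FIXED POINT FROM ULTRALOCALITY, DIRECTLY**: if the explicit difference `defect TP RP m` is supported at the origin for every
`m ≥ 1`, road FP's binder `∀ m ≥ 1, secondMoment (defect TP RP m) μ ν = 0` holds (no limit, no majorant needed). -/
theorem hSDF_of_ultralocal {TP RP : ℕ → B12Beta.Kernel 4} (h : ∀ m, 1 ≤ m → ∀ μ ν x, x ≠ 0 → defect TP RP m μ ν x = 0) (μ ν : Fin 4) :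
    ∀ m, 1 ≤ m → B12Beta.secondMoment (defect TP RP m) μ ν = 0 := fun m hm =>
  secondMoment_eq_zero_of_ultralocal (defect TP RP m) (h m hm) μ ν

/-- [folklore] **THE STEP LAW MODULO AN ULTRALOCAL TERM GIVES `hSDF`**: if at the fixed point `TP (m+1) = RP m + TP m + U m` OFF THE ORIGIN with `U m`
ultralocal (`m ≥ 1`), then `secondMoment (defect TP RP m) μ ν = 0` — the (STEP) door asks for «defect ultralocal», not «defect zero». -/
theorem hSDF_of_stepLaw_mod_ultralocal {TP RP U : ℕ → B12Beta.Kernel 4}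
    (hlaw : ∀ m, 1 ≤ m → ∀ μ ν x, x ≠ 0 → TP (m + 1) μ ν x = RP m μ ν x + TP m μ ν x + U m μ ν x)
    (hU : ∀ m, 1 ≤ m → ∀ μ ν x, x ≠ 0 → U m μ ν x = 0) (μ ν : Fin 4) :
    ∀ m, 1 ≤ m → B12Beta.secondMoment (defect TP RP m) μ ν = 0 :=
  hSDF_of_ultralocal (fun m hm μ ν x hx => by unfold defect; rw [hlaw m hm μ ν x hx, hU m hm μ ν x hx]; ring) μ ν

/-! ## §4 Reflection-even kernels: the off-diagonal second moments vanish by parity (no support hypothesis) -/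

/-- [folklore] the coordinate reflection `z ↦ (z with z_μ ↦ −z_μ)` is an involution. -/
theorem reflect_reflect (μ : Fin d) (z : Fin d → ℤ) : Function.update (Function.update z μ (-z μ)) μ (-(Function.update z μ (-z μ)) μ) = z := by
  ext i
  by_cases h : i = μ
  · subst h; simp
  · simp [h]

/-- [folklore] **A KERNEL EVEN UNDER THE REFLECTION `z_μ ↦ −z_μ` HAS ZERO `(μ, ν)` SECOND MOMENT FOR `μ ≠ ν`** (the weight `z_μ z_ν` is odd; no support or
summability hypothesis — `tsum` is reflection-invariant and commutes with negation unconditionally).  Use: a residual step-defect term of any range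
(ultralocal, block-local or bubble-type — a per-bond scalar contracted through two `ℋ`-columns, R-D1-g36-1 (D)) is invisible in Bałaban's channels `μ ≠ ν`
((1.22) p. 264: «μ, ν arbitrary, μ ≠ ν»; the END p307920 carries `hμν : μ ≠ ν`) as soon as it is reflection-even. -/
theorem secondMoment_eq_zero_of_reflect_even (P : B12Beta.Kernel d) (μ ν : Fin d) (hμν : μ ≠ ν)
    (heven : ∀ z, P μ ν (Function.update z μ (-z μ)) = P μ ν z) :
    B12Beta.secondMoment P μ ν = 0 := by
  unfold B12Beta.secondMoment
  set R : Equiv.Perm (Fin d → ℤ) := Function.Involutive.toPerm (fun z => Function.update z μ (-z μ)) (fun z => reflect_reflect μ z) with hR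
  -- the summand changes sign under the reflection
  have hodd : ∀ z, P μ ν (R z) * ((R z) μ : ℝ) * ((R z) ν : ℝ) = -(P μ ν z * (z μ : ℝ) * (z ν : ℝ)) := fun z => by
    show P μ ν (Function.update z μ (-z μ)) * ((Function.update z μ (-z μ)) μ : ℝ) * ((Function.update z μ (-z μ)) ν : ℝ) = _
    rw [heven z, Function.update_self, Function.update_of_ne (Ne.symm hμν)]
    push_cast; ring
  have h1 : ∑' z, P μ ν z * (z μ : ℝ) * (z ν : ℝ) = ∑' z, P μ ν (R z) * ((R z) μ : ℝ) * ((R z) ν : ℝ) :=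
    (Equiv.tsum_eq R (fun z => P μ ν z * (z μ : ℝ) * (z ν : ℝ))).symm
  simp only [hodd, tsum_neg] at h1
  linarith

/-- [folklore] **THE STEP LAW MODULO A REFLECTION-EVEN TERM GIVES `hSDF` IN THE CHANNELS `μ ≠ ν`**: if at the fixed point `TP (m+1) = RP m + TP m + U m`
entrywise in the channel `(μ, ν)` with `U m μ ν` even under `z_μ ↦ −z_μ` (`m ≥ 1`), then `secondMoment (defect TP RP m) μ ν = 0`. -/
theorem hSDF_of_stepLaw_mod_reflect_even {TP RP U : ℕ → B12Beta.Kernel 4} (μ ν : Fin 4) (hμν : μ ≠ ν)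
    (hlaw : ∀ m, 1 ≤ m → ∀ x, TP (m + 1) μ ν x = RP m μ ν x + TP m μ ν x + U m μ ν x)
    (hU : ∀ m, 1 ≤ m → ∀ z, U m μ ν (Function.update z μ (-z μ)) = U m μ ν z) :
    ∀ m, 1 ≤ m → B12Beta.secondMoment (defect TP RP m) μ ν = 0 := fun m hm => by
  have hD : ∀ z, defect TP RP m μ ν z = U m μ ν z := fun z => by unfold defect; rw [hlaw m hm z]; ring
  refine secondMoment_eq_zero_of_reflect_even _ μ ν hμν fun z => ?_
  rw [hD, hD, hU m hm z]

end Summit.QuantumFields.BalabanUV.Beta.FP.UltralocalDefect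

end
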